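import Summits.FinalStateConjecture.FinalStateConjecture.Theses.PhotonSphereChannels
import Summits.FinalStateConjecture.FinalStateConjecture.Theorems.PhotonSphereChannelsExteriorEnergyRW
import Summits.FinalStateConjecture.FinalStateConjecture.Theorems.WindowedShellChannels.Negative.InfiniteEnergy
import Summits.FinalStateConjecture.FinalStateConjecture.Theorems.PhotonSphereChannelsWindowedShellChannelsStubUnitMass

/-!
# Crux `WindowedShellChannels` (stmt-FinalStateConjecture-14085) — line `SketchIdeator3`, lead skeleton v3
# (lead prover-line-stmt-FinalStateConjecture-14085-1; reshaped through the card `outward-completion-duality`)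

Composition (all names in `…Theorems.WindowedShellChannelsStubs`; σ = time parity, `+1` even / `−1` odd):
```
W ⇐ stub_parity                     (LANDED p86825)   W_even → W_odd → W
  ⇐ stub_finiteEnergy σ             (LANDED p87507)   finite-energy form → general form
  ⇐ stub_recentre σ                 (LANDED p88529)   centred tortoise line (xc = 0) → general (r, xc)
  ⇐ stub_unitMass σ                 (LANDED p89324)   M = 1 → general M
  ⇐ core σ := core_of_duality_escape stub_duality (stub_escape σ)      (PROVED glue, this file)
  ⇐ stub_duality                    (OPEN, M)  two-solution completion duality for ψ_tt − ψ_xx + Vψ = 0, V ≥ 0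
  ⇐ stub_escapeEven, stub_escapeOdd (OPEN)     every parity-pure off-shell datum has a finite-energy PARTNER solution
                                               with pairing ⟨φ, ψ⟩_E(0) = E(ψ), E(φ) ≤ A·E(ψ), whose forward loss behind the
                                               lagged cone is ≤ θ²·E(ψ), θ < 1, uniformly in s ≤ 2 ≤ …, ℓ ≥ s (unit mass,
                                               centred line; canonical partners = OUTWARD completions).
```
`WindowedShellChannels_of` concludes the crux BY NAME; sorries only in `stub_duality`, `stub_escapeEven`,
`stub_escapeOdd`.

Duality (why the glue is right).  Let `Q_t`, `P_t` be the energies outside / inside the lagged cone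
`{ρ − h + |t| < |x|}` at time `t` (positive quadratic forms in the solution, `Q_t + P_t = E`, `E` conserved by
`RW.totalEnergy_eq_totalEnergy`), and `B_t = B_t^Q + B_t^P` the polarised pairing, conserved in `t`.  From
`B_0(φ, ψ) = E(ψ)`: `E(ψ) = B_t^Q(φ,ψ) + B_t^P(φ,ψ) ≤ √(Q_t(φ)Q_t(ψ)) + √(P_t(φ)P_t(ψ)) ≤ √(E(φ)·Q_t(ψ)) + √(P_t(φ)·E(ψ))`;
as `t → +∞`, `Q_t(ψ) → caught⁺(ψ)` and `P_t(φ) → E(φ) − caught⁺(φ) ≤ θ²E(ψ)`, so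
`(1 − θ)E(ψ) ≤ √(A·E(ψ)·caught⁺(ψ))`, i.e. `caught⁺(ψ) ≥ ((1 − θ)²/A)·E(ψ)`.
-/

noncomputable section

set_option linter.dupNamespace false

namespace Summit.FinalStateConjecture.FinalStateConjecture.Theorems.WindowedShellChannelsLine

open Literature.Geometry.Lorentzian Literature.Geometry.Lorentzian.ReggeWheeler
open Summit.FinalStateConjecture.FinalStateConjecture.Theses.PhotonSphereChannels
open Filter Set MeasureTheory
open scoped ENNReal Topology

/-! ## VERBATIM PRIVATE COPIES of three LANDED reductions (p86825 `stub_parity`, p87507 `stub_finiteEnergy`,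
p88529 `stub_recentre`; tree files `Theorems/PhotonSphereChannelsWindowedShellChannelsStub{Parity,FiniteEnergy,Recentre}.lean`).
Reason: those modules (landed 06:52–07:19Z 2026-08-16) are absent from every Lean-farm snapshot ("remote:stale:…:unbuilt"),
so a skeleton importing them cannot be elaborated or registered; the canonical skeleton `work/WindowedShellChannels.lean`
imports them by name and is byte-identical below the copies.  Namespace `…WindowedShellChannelsLine` avoids any clash. -/

namespace Parity

section ParityCalculus

variable {V : ℝ → ℝ} {ψ : ℝ → ℝ → ℝ}

/-- `t`-slices of a `C²` function of `(t, x)` are `C²`. -/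
theorem contDiff_slice_fst (hψ : ContDiff ℝ 2 (Function.uncurry ψ)) (x : ℝ) :
    ContDiff ℝ 2 (fun τ => ψ τ x) :=
  hψ.comp (contDiff_id.prodMk contDiff_const)

/-- `x`-slices of a `C²` function of `(t, x)` are `C²`. -/
theorem contDiff_slice_snd (hψ : ContDiff ℝ 2 (Function.uncurry ψ)) (t : ℝ) :
    ContDiff ℝ 2 (ψ t) :=
  hψ.comp (contDiff_const.prodMk contDiff_id)

/-- Reflected `t`-slices `τ ↦ ψ(−τ, x)` of a `C²` function are `C²`. -/
theorem contDiff_slice_fst_reflect (hψ : ContDiff ℝ 2 (Function.uncurry ψ)) (x : ℝ) :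
    ContDiff ℝ 2 (fun τ => ψ (-τ) x) :=
  (contDiff_slice_fst hψ x).comp contDiff_neg

/-- The parity combination `a ψ(t, x) + b ψ(−t, x)` of a `C²` function is `C²`. -/
theorem contDiff_uncurry_comb (hψ : ContDiff ℝ 2 (Function.uncurry ψ)) (a b : ℝ) :
    ContDiff ℝ 2 (Function.uncurry fun t x => a * ψ t x + b * ψ (-t) x) :=
  (contDiff_const.mul hψ).add
    (contDiff_const.mul (hψ.comp (contDiff_fst.neg.prodMk contDiff_snd)))

/-- `∂_t` of the parity combination. -/
theorem deriv_comb_fst (hψ : ContDiff ℝ 2 (Function.uncurry ψ)) (a b t x : ℝ) :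
    deriv (fun τ => a * ψ τ x + b * ψ (-τ) x) t
      = a * deriv (fun τ => ψ τ x) t - b * deriv (fun τ => ψ τ x) (-t) := by
  have hf := (contDiff_slice_fst hψ x).differentiable (by norm_num)
  have hg := (contDiff_slice_fst_reflect hψ x).differentiable (by norm_num)
  rw [deriv_fun_add ((hf t).const_mul a) ((hg t).const_mul b), deriv_const_mul_field,
    deriv_const_mul_field, deriv_comp_neg (fun τ => ψ τ x) t]
  ring

/-- `∂_x` of the parity combination. -/
theorem deriv_comb_snd (hψ : ContDiff ℝ 2 (Function.uncurry ψ)) (a b t x : ℝ) :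
    deriv (fun y => a * ψ t y + b * ψ (-t) y) x = a * deriv (ψ t) x + b * deriv (ψ (-t)) x := by
  have hf := (contDiff_slice_snd hψ t).differentiable (by norm_num)
  have hg := (contDiff_slice_snd hψ (-t)).differentiable (by norm_num)
  rw [deriv_fun_add ((hf x).const_mul a) ((hg x).const_mul b), deriv_const_mul_field,
    deriv_const_mul_field]

/-- `∂_t²` of the parity combination. -/
theorem iteratedDeriv_comb_fst (hψ : ContDiff ℝ 2 (Function.uncurry ψ)) (a b t x : ℝ) :
    iteratedDeriv 2 (fun τ => a * ψ τ x + b * ψ (-τ) x) t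
      = a * iteratedDeriv 2 (fun τ => ψ τ x) t + b * iteratedDeriv 2 (fun τ => ψ τ x) (-t) := by
  have h1 : ContDiffAt ℝ 2 (fun τ => a * ψ τ x) t :=
    (contDiff_const.mul (contDiff_slice_fst hψ x)).contDiffAt
  have h2 : ContDiffAt ℝ 2 (fun τ => b * ψ (-τ) x) t :=
    (contDiff_const.mul (contDiff_slice_fst_reflect hψ x)).contDiffAt
  rw [iteratedDeriv_fun_add h1 h2, iteratedDeriv_const_mul_field, iteratedDeriv_const_mul_field,
    iteratedDeriv_comp_neg 2 (fun τ => ψ τ x) t]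
  simp

/-- `∂_x²` of the parity combination. -/
theorem iteratedDeriv_comb_snd (hψ : ContDiff ℝ 2 (Function.uncurry ψ)) (a b t x : ℝ) :
    iteratedDeriv 2 (fun y => a * ψ t y + b * ψ (-t) y) x
      = a * iteratedDeriv 2 (ψ t) x + b * iteratedDeriv 2 (ψ (-t)) x := by
  have h1 : ContDiffAt ℝ 2 (fun y => a * ψ t y) x :=
    (contDiff_const.mul (contDiff_slice_snd hψ t)).contDiffAt
  have h2 : ContDiffAt ℝ 2 (fun y => b * ψ (-t) y) x :=
    (contDiff_const.mul (contDiff_slice_snd hψ (-t))).contDiffAt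
  rw [iteratedDeriv_fun_add h1 h2, iteratedDeriv_const_mul_field, iteratedDeriv_const_mul_field]

/-- The parity combination of a solution is a solution (`(½, ½)`: even part, data `(ψ₀, 0)`;
`(½, −½)`: odd part, data `(0, ψ₁)`; `(0, 1)`: time reflection). -/
theorem isSolution_comb (hψ : IsSolution V ψ) (a b : ℝ) :
    IsSolution V (fun t x => a * ψ t x + b * ψ (-t) x) := by
  refine ⟨contDiff_uncurry_comb hψ.1 a b, fun z => ?_⟩
  obtain ⟨t, x⟩ := z
  have h1 := hψ.2 (t, x)
  have h2 := hψ.2 (-t, x)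
  unfold IsSolutionAt at h1 h2 ⊢
  simp only at h1 h2 ⊢
  rw [iteratedDeriv_comb_fst hψ.1, iteratedDeriv_comb_snd hψ.1]
  linear_combination a * h1 + b * h2

/-- Cauchy data of the parity combination vanish wherever those of `ψ` do. -/
theorem supported_comb (hψ : ContDiff ℝ 2 (Function.uncurry ψ)) {S : Set ℝ}
    (hsupp : CauchyDataSupportedOn ψ S) (a b : ℝ) :
    CauchyDataSupportedOn (fun t x => a * ψ t x + b * ψ (-t) x) S := by
  intro x hx
  obtain ⟨h0, h1⟩ := hsupp x hx
  refine ⟨?_, ?_⟩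
  · show a * ψ 0 x + b * ψ (-0) x = 0
    rw [neg_zero, h0, mul_zero, mul_zero, add_zero]
  · show deriv (fun τ => a * ψ τ x + b * ψ (-τ) x) 0 = 0
    rw [deriv_comb_fst hψ, neg_zero, h1, mul_zero, mul_zero, sub_zero]

/-- The energy density of the parity combination in terms of `ψ`. -/
theorem energyDensity_comb (hψ : ContDiff ℝ 2 (Function.uncurry ψ)) (a b t x : ℝ) :
    energyDensity V (fun t x => a * ψ t x + b * ψ (-t) x) t x
      = (a * deriv (fun τ => ψ τ x) t - b * deriv (fun τ => ψ τ x) (-t)) ^ 2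
        + (a * deriv (ψ t) x + b * deriv (ψ (-t)) x) ^ 2
        + V x * (a * ψ t x + b * ψ (-t) x) ^ 2 := by
  simp only [energyDensity, deriv_comb_fst hψ, deriv_comb_snd hψ]

/-- Parallelogram law, pointwise: `e[ψ](t, x) + e[ψ](−t, x) = 2e[ψ_e](t, x) + 2e[ψ_o](t, x)`. -/
theorem energyDensity_parity_split (hψ : ContDiff ℝ 2 (Function.uncurry ψ)) (t x : ℝ) :
    energyDensity V ψ t x + energyDensity V ψ (-t) x
      = 2 * energyDensity V (fun t x => 2⁻¹ * ψ t x + 2⁻¹ * ψ (-t) x) t x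
        + 2 * energyDensity V (fun t x => 2⁻¹ * ψ t x + -2⁻¹ * ψ (-t) x) t x := by
  rw [energyDensity_comb hψ, energyDensity_comb hψ]
  unfold energyDensity
  ring

/-- The energy density of a `C²` function along a continuous potential is measurable in `x`
(it is continuous: the partials are values of the continuous Fréchet derivative). -/
theorem measurable_energyDensity (hV : Continuous V) (hψ : ContDiff ℝ 2 (Function.uncurry ψ))
    (t : ℝ) : Measurable fun x => ENNReal.ofReal (energyDensity V ψ t x) := by
  have hp : Continuous fun x : ℝ => ((t, x) : ℝ × ℝ) := continuous_const.prodMk continuous_id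
  have h1 : Continuous fun x => fderiv ℝ (Function.uncurry ψ) (t, x) (1, 0) :=
    (WaveEnergy.continuous_fderiv_apply hψ (1, 0)).comp hp
  have h2 : Continuous fun x => fderiv ℝ (Function.uncurry ψ) (t, x) (0, 1) :=
    (WaveEnergy.continuous_fderiv_apply hψ (0, 1)).comp hp
  have h3 : Continuous fun x => ψ t x := hψ.continuous.comp hp
  have heq : (fun x => energyDensity V ψ t x) = fun x =>
      (fderiv ℝ (Function.uncurry ψ) (t, x) (1, 0)) ^ 2
        + (fderiv ℝ (Function.uncurry ψ) (t, x) (0, 1)) ^ 2 + V x * ψ t x ^ 2 := by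
    funext x
    simp only [energyDensity, WaveEnergy.deriv_slice_fst_eq hψ, WaveEnergy.deriv_slice_snd_eq hψ]
  have hc : Continuous fun x => energyDensity V ψ t x := by
    rw [heq]
    exact ((h1.pow 2).add (h2.pow 2)).add (hV.mul (h3.pow 2))
  exact ENNReal.measurable_ofReal.comp hc.measurable

/-- Parity split of the exterior energies of EVERY aperture `a` (lagged ones included):
`E_a[ψ](t) + E_a[ψ](−t) = 2E_a[ψ_e](t) + 2E_a[ψ_o](t)`. -/
theorem exteriorEnergy_parity_split (hV : Continuous V) (hV0 : ∀ x, 0 ≤ V x)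
    (hψ : ContDiff ℝ 2 (Function.uncurry ψ)) (xc a t : ℝ) :
    exteriorEnergy V xc a ψ t + exteriorEnergy V xc a ψ (-t)
      = 2 * exteriorEnergy V xc a (fun t x => 2⁻¹ * ψ t x + 2⁻¹ * ψ (-t) x) t
        + 2 * exteriorEnergy V xc a (fun t x => 2⁻¹ * ψ t x + -2⁻¹ * ψ (-t) x) t := by
  unfold exteriorEnergy
  rw [abs_neg, ← lintegral_add_left (measurable_energyDensity hV hψ t),
    ← lintegral_const_mul' _ _ (by simp), ← lintegral_const_mul' _ _ (by simp),
    ← lintegral_add_left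
      ((measurable_energyDensity hV (contDiff_uncurry_comb hψ _ _) t).const_mul 2)]
  refine lintegral_congr fun x => ?_
  have he : 0 ≤ energyDensity V (fun t x => 2⁻¹ * ψ t x + 2⁻¹ * ψ (-t) x) t x :=
    energyDensity_nonneg _ _ (hV0 x)
  have ho : 0 ≤ energyDensity V (fun t x => 2⁻¹ * ψ t x + -2⁻¹ * ψ (-t) x) t x :=
    energyDensity_nonneg _ _ (hV0 x)
  rw [← ENNReal.ofReal_add (energyDensity_nonneg _ _ (hV0 x)) (energyDensity_nonneg _ _ (hV0 x)),
    energyDensity_parity_split hψ, ENNReal.ofReal_add (by positivity) (by positivity),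
    ENNReal.ofReal_mul zero_le_two, ENNReal.ofReal_mul zero_le_two, ENNReal.ofReal_ofNat]

/-- At `t = 0` the energy splits: `E(ψ) = E(ψ_e) + E(ψ_o)`. -/
theorem totalEnergy_zero_split (hV : Continuous V) (hV0 : ∀ x, 0 ≤ V x)
    (hψ : ContDiff ℝ 2 (Function.uncurry ψ)) :
    totalEnergy V ψ 0 = totalEnergy V (fun t x => 2⁻¹ * ψ t x + 2⁻¹ * ψ (-t) x) 0
      + totalEnergy V (fun t x => 2⁻¹ * ψ t x + -2⁻¹ * ψ (-t) x) 0 := by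
  unfold totalEnergy
  rw [← lintegral_add_left (measurable_energyDensity hV (contDiff_uncurry_comb hψ _ _) 0)]
  refine lintegral_congr fun x => ?_
  rw [← ENNReal.ofReal_add (energyDensity_nonneg _ _ (hV0 x)) (energyDensity_nonneg _ _ (hV0 x))]
  congr 1
  have h := energyDensity_parity_split (V := V) hψ 0 x
  rw [neg_zero] at h
  linarith

end ParityCalculus

/-! ### Convergence of exterior energies for every aperture; the channel form of the split -/

section Channels

variable {V : ℝ → ℝ} {ψ : ℝ → ℝ → ℝ}

/-- Time shifts `ψ(· + c, ·)` of a solution are solutions. -/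
theorem isSolution_tshift (hψ : IsSolution V ψ) (c : ℝ) :
    IsSolution V (fun t x => ψ (t + c) x) := by
  refine ⟨hψ.1.comp ((contDiff_fst.add contDiff_const).prodMk contDiff_snd), fun z => ?_⟩
  have h := hψ.2 (z.1 + c, z.2)
  have h1 : iteratedDeriv 2 (fun τ => ψ (τ + c) z.2) z.1
      = iteratedDeriv 2 (fun τ => ψ τ z.2) (z.1 + c) := by
    rw [iteratedDeriv_comp_add_const 2 (fun τ => ψ τ z.2) c]
  unfold IsSolutionAt at h ⊢
  simp only at h ⊢
  rw [h1]
  exact h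

/-- For `t ≥ 0`, `t + a ≥ 0` the exterior energy of aperture `a` at time `t` is the exterior energy
of aperture `0` at time `t + a` of the solution shifted in time by `−a`. -/
theorem exteriorEnergy_eq_tshift (V : ℝ → ℝ) (xc : ℝ) {a t : ℝ} (ht : 0 ≤ t) (hta : 0 ≤ t + a)
    (ψ : ℝ → ℝ → ℝ) :
    exteriorEnergy V xc a ψ t = exteriorEnergy V xc 0 (fun s x => ψ (s + -a) x) (t + a) := by
  unfold exteriorEnergy
  have hset : {x : ℝ | a + |t| < |x - xc|} = {x : ℝ | 0 + |t + a| < |x - xc|} := by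
    ext x
    simp only [mem_setOf_eq]
    rw [abs_of_nonneg ht, abs_of_nonneg hta]
    constructor <;> intro h <;> linarith
  rw [hset]
  refine lintegral_congr fun x => ?_
  unfold energyDensity
  rw [deriv_comp_add_const (fun τ => ψ τ x) (-a) (t + a)]
  simp

/-- Exterior energies of a solution are non-increasing on `t ≥ max 0 (−a)` for EVERY aperture `a`
(negative, i.e. lagged, apertures included). -/
theorem exteriorEnergy_antitoneOn_tail (hV : Differentiable ℝ V) (hV0 : ∀ x, 0 ≤ V x)
    (hψ : IsSolution V ψ) (xc a : ℝ) :
    AntitoneOn (exteriorEnergy V xc a ψ) (Ici (max 0 (-a))) := by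
  intro t₁ ht₁ t₂ ht₂ h12
  simp only [mem_Ici, max_le_iff] at ht₁ ht₂
  rw [exteriorEnergy_eq_tshift V xc ht₁.1 (by linarith) ψ,
    exteriorEnergy_eq_tshift V xc ht₂.1 (by linarith) ψ]
  exact (RW.exteriorEnergy_antitoneOn hV hV0 (isSolution_tshift hψ (-a)) xc le_rfl).1
    (by simp only [mem_Ici]; linarith) (by simp only [mem_Ici]; linarith) (by linarith)

/-- **Convergence forward**: the exterior energy tends to the forward channel energy. -/
theorem tendsto_exteriorEnergy_atTop (hV : Differentiable ℝ V) (hV0 : ∀ x, 0 ≤ V x)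
    (hψ : IsSolution V ψ) (xc a : ℝ) :
    Tendsto (exteriorEnergy V xc a ψ) atTop (𝓝 (channelEnergy V xc a ψ atTop)) := by
  set T₀ : ℝ := max 0 (-a) with hT₀
  have hanti := exteriorEnergy_antitoneOn_tail hV hV0 hψ xc a
  set g : ℝ → ℝ≥0∞ := fun t => exteriorEnergy V xc a ψ (max t T₀) with hg_def
  have hg : Antitone g := fun t t' htt' =>
    hanti (mem_Ici.2 (le_max_right t T₀)) (mem_Ici.2 (le_max_right t' T₀))
      (max_le_max htt' le_rfl)
  have heq : g =ᶠ[atTop] exteriorEnergy V xc a ψ := by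
    filter_upwards [eventually_ge_atTop T₀] with t ht
    simp [hg_def, max_eq_left ht]
  have hlimE : Tendsto (exteriorEnergy V xc a ψ) atTop (𝓝 (⨅ t, g t)) :=
    (tendsto_atTop_iInf hg).congr' heq
  have hch : channelEnergy V xc a ψ atTop = ⨅ t, g t := hlimE.liminf_eq
  rw [hch]
  exact hlimE

/-- Time reversal of exterior energies: `E_a[ψ(−·)](t) = E_a[ψ](−t)`. -/
theorem exteriorEnergy_reflect (hψ : ContDiff ℝ 2 (Function.uncurry ψ)) (xc a t : ℝ) :
    exteriorEnergy V xc a (fun t x => 0 * ψ t x + 1 * ψ (-t) x) t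
      = exteriorEnergy V xc a ψ (-t) := by
  unfold exteriorEnergy
  rw [abs_neg]
  refine lintegral_congr fun x => ?_
  rw [energyDensity_comb hψ]
  unfold energyDensity
  congr 1
  ring

/-- **Convergence backward**: the exterior energy tends to the backward channel energy. -/
theorem tendsto_exteriorEnergy_atBot (hV : Differentiable ℝ V) (hV0 : ∀ x, 0 ≤ V x)
    (hψ : IsSolution V ψ) (xc a : ℝ) :
    Tendsto (exteriorEnergy V xc a ψ) atBot (𝓝 (channelEnergy V xc a ψ atBot)) := by
  have h := tendsto_exteriorEnergy_atTop hV hV0 (isSolution_comb hψ 0 1) xc a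
  have hfun : exteriorEnergy V xc a ψ
      = exteriorEnergy V xc a (fun t x => 0 * ψ t x + 1 * ψ (-t) x) ∘ Neg.neg := by
    funext t
    rw [Function.comp_apply, exteriorEnergy_reflect hψ.1, neg_neg]
  have hch : channelEnergy V xc a ψ atBot
      = channelEnergy V xc a (fun t x => 0 * ψ t x + 1 * ψ (-t) x) atTop := by
    unfold channelEnergy
    rw [hfun, Filter.liminf_comp, Filter.map_neg_atBot]
  rw [hch, hfun]
  exact h.comp tendsto_neg_atBot_atTop

/-- **Channel form of the parity split**: `ch⁺(ψ) + ch⁻(ψ) = 2ch⁺(ψ_e) + 2ch⁺(ψ_o)` for every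
aperture. -/
theorem channel_parity_split (hV : Differentiable ℝ V) (hV0 : ∀ x, 0 ≤ V x)
    (hψ : IsSolution V ψ) (xc a : ℝ) :
    channelEnergy V xc a ψ atTop + channelEnergy V xc a ψ atBot
      = 2 * channelEnergy V xc a (fun t x => 2⁻¹ * ψ t x + 2⁻¹ * ψ (-t) x) atTop
        + 2 * channelEnergy V xc a (fun t x => 2⁻¹ * ψ t x + -2⁻¹ * ψ (-t) x) atTop := by
  have h1 := tendsto_exteriorEnergy_atTop hV hV0 hψ xc a
  have h2 := (tendsto_exteriorEnergy_atBot hV hV0 hψ xc a).comp tendsto_neg_atTop_atBot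
  have he := tendsto_exteriorEnergy_atTop hV hV0 (isSolution_comb hψ 2⁻¹ 2⁻¹) xc a
  have ho := tendsto_exteriorEnergy_atTop hV hV0 (isSolution_comb hψ 2⁻¹ (-2⁻¹)) xc a
  refine tendsto_nhds_unique ?_
    ((ENNReal.Tendsto.const_mul he (Or.inr (by simp))).add
      (ENNReal.Tendsto.const_mul ho (Or.inr (by simp))))
  exact (h1.add h2).congr fun t => exteriorEnergy_parity_split hV.continuous hV0 hψ.1 xc a t

/-- Channel energies are monotone in the aperture (a smaller aperture sees more energy). -/
theorem channelEnergy_mono_aperture (V : ℝ → ℝ) (xc : ℝ) {ρ ρ' : ℝ} (hρ : ρ' ≤ ρ)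
    (ψ : ℝ → ℝ → ℝ) (l : Filter ℝ) :
    channelEnergy V xc ρ ψ l ≤ channelEnergy V xc ρ' ψ l := by
  refine Filter.liminf_le_liminf (Eventually.of_forall fun t => ?_)
  unfold exteriorEnergy
  refine lintegral_mono_set fun x hx => ?_
  simp only [mem_setOf_eq] at hx ⊢
  linarith

end Channels

end Parity

/-- REDUCTION (parity regrading; ideator 3's `parityTransfer_mpr`, kernel-checked in
`Cruxes/WindowedShellChannels/SketchIdeator3.lean`): exterior energies converge for every (lagged) aperture, time
reversal ⊗ parallelogram law give `ch⁺(ψ) + ch⁻(ψ) = 2ch⁺(ψ_even) + 2ch⁺(ψ_odd)` and `E(ψ) = E(ψ_even) + E(ψ_odd)` at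
`t = 0`, the even/odd parts of an RW solution are RW solutions with data `(ψ₀,0)` / `(0,ψ₁)` still supported off the
shell; constants `h := max h_e h_o`, `c := 2 min c_e c_o`. -/
theorem landed_parity
    (He : ∀ M : ℝ, 0 < M → ∀ ρ : ℝ, 0 < ρ → ∃ h : ℝ, 0 ≤ h ∧ ∃ c : ℝ, 0 < c ∧ ∀ (r : ℝ → ℝ) (xc : ℝ),
        IsTortoiseRadius M r xc → ∀ (s ℓ : ℕ), s ≤ 2 → s ≤ ℓ → ∀ ψ : ℝ → ℝ → ℝ,
          IsRWSolution M s ℓ r ψ → (∀ t x, ψ (-t) x = ψ t x) →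
          CauchyDataSupportedOn ψ {x : ℝ | ρ < |x - xc|} →
            ENNReal.ofReal c * totalEnergy (linePotential M s ℓ r) ψ 0 ≤
              channelEnergy (linePotential M s ℓ r) xc (ρ - h) ψ atTop)
    (Ho : ∀ M : ℝ, 0 < M → ∀ ρ : ℝ, 0 < ρ → ∃ h : ℝ, 0 ≤ h ∧ ∃ c : ℝ, 0 < c ∧ ∀ (r : ℝ → ℝ) (xc : ℝ),
        IsTortoiseRadius M r xc → ∀ (s ℓ : ℕ), s ≤ 2 → s ≤ ℓ → ∀ ψ : ℝ → ℝ → ℝ,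
          IsRWSolution M s ℓ r ψ → (∀ t x, ψ (-t) x = -ψ t x) →
          CauchyDataSupportedOn ψ {x : ℝ | ρ < |x - xc|} →
            ENNReal.ofReal c * totalEnergy (linePotential M s ℓ r) ψ 0 ≤
              channelEnergy (linePotential M s ℓ r) xc (ρ - h) ψ atTop) :
    -- (conclusion = the body of `WindowedShellChannels`, inlined so that only `WindowedShellChannels_of`
    -- concludes the crux by name in this skeleton file)
    ∀ M : ℝ, 0 < M → ∀ ρ : ℝ, 0 < ρ → ∃ h : ℝ, 0 ≤ h ∧ ∃ c : ℝ, 0 < c ∧ ∀ (r : ℝ → ℝ) (xc : ℝ),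
      IsTortoiseRadius M r xc → ∀ (s ℓ : ℕ), s ≤ 2 → s ≤ ℓ → ∀ ψ : ℝ → ℝ → ℝ, IsRWSolution M s ℓ r ψ →
        CauchyDataSupportedOn ψ {x : ℝ | ρ < |x - xc|} →
          ENNReal.ofReal c * totalEnergy (linePotential M s ℓ r) ψ 0 ≤
            channelEnergy (linePotential M s ℓ r) xc (ρ - h) ψ atTop +
              channelEnergy (linePotential M s ℓ r) xc (ρ - h) ψ atBot := by
  intro M hM ρ hρ
  obtain ⟨h₁, hh₁, c₁, hc₁, H₁⟩ := He M hM ρ hρ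
  obtain ⟨h₂, hh₂, c₂, hc₂, H₂⟩ := Ho M hM ρ hρ
  refine ⟨max h₁ h₂, le_trans hh₁ (le_max_left _ _), 2 * min c₁ c₂, by positivity, ?_⟩
  intro r xc hr s ℓ hs hsℓ ψ hψ hsupp
  have hV : Differentiable ℝ (linePotential M s ℓ r) := RW.differentiable_linePotential hr s ℓ
  have hV0 : ∀ x, 0 ≤ linePotential M s ℓ r x := fun x => (RW.linePotential_pos hr hsℓ x).le
  have heven : ∀ t x, 2⁻¹ * ψ (-t) x + 2⁻¹ * ψ (- -t) x = 2⁻¹ * ψ t x + 2⁻¹ * ψ (-t) x := by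
    intro t x; rw [neg_neg, add_comm]
  have hodd : ∀ t x,
      2⁻¹ * ψ (-t) x + -2⁻¹ * ψ (- -t) x = -(2⁻¹ * ψ t x + -2⁻¹ * ψ (-t) x) := by
    intro t x; rw [neg_neg]; ring
  have K₁ := (H₁ r xc hr s ℓ hs hsℓ _ (Parity.isSolution_comb hψ 2⁻¹ 2⁻¹) heven
    (Parity.supported_comb hψ.1 hsupp _ _)).trans (Parity.channelEnergy_mono_aperture _ xc
      (show ρ - max h₁ h₂ ≤ ρ - h₁ by linarith [le_max_left h₁ h₂]) _ atTop)
  have K₂ := (H₂ r xc hr s ℓ hs hsℓ _ (Parity.isSolution_comb hψ 2⁻¹ (-2⁻¹)) hodd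
    (Parity.supported_comb hψ.1 hsupp _ _)).trans (Parity.channelEnergy_mono_aperture _ xc
      (show ρ - max h₁ h₂ ≤ ρ - h₂ by linarith [le_max_right h₁ h₂]) _ atTop)
  have hc1 : ENNReal.ofReal (min c₁ c₂) ≤ ENNReal.ofReal c₁ :=
    ENNReal.ofReal_le_ofReal (min_le_left _ _)
  have hc2 : ENNReal.ofReal (min c₁ c₂) ≤ ENNReal.ofReal c₂ :=
    ENNReal.ofReal_le_ofReal (min_le_right _ _)
  rw [Parity.channel_parity_split hV hV0 hψ xc (ρ - max h₁ h₂),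
    Parity.totalEnergy_zero_split hV.continuous hV0 hψ.1, ENNReal.ofReal_mul zero_le_two,
    ENNReal.ofReal_ofNat, mul_add, mul_assoc, mul_assoc]
  exact add_le_add (mul_le_mul_right ((mul_le_mul_left hc1 _).trans K₁) 2)
    (mul_le_mul_right ((mul_le_mul_left hc2 _).trans K₂) 2)



/-- REDUCTION (finite energy): an infinite-energy solution has forward lagged channel energy `⊤`
(`Theorems.WindowedShellChannels.Negative.channelEnergy_eq_top_of_totalEnergy_eq_top`), so the inequality is free
there and the same `(h, c)` work. -/
theorem landed_finiteEnergy (σ : ℝ)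
    (H : ∀ M : ℝ, 0 < M → ∀ ρ : ℝ, 0 < ρ → ∃ h : ℝ, 0 ≤ h ∧ ∃ c : ℝ, 0 < c ∧ ∀ (r : ℝ → ℝ) (xc : ℝ),
        IsTortoiseRadius M r xc → ∀ (s ℓ : ℕ), s ≤ 2 → s ≤ ℓ → ∀ ψ : ℝ → ℝ → ℝ,
          IsRWSolution M s ℓ r ψ → (∀ t x, ψ (-t) x = σ * ψ t x) →
          CauchyDataSupportedOn ψ {x : ℝ | ρ < |x - xc|} →
          totalEnergy (linePotential M s ℓ r) ψ 0 ≠ ⊤ →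
            ENNReal.ofReal c * totalEnergy (linePotential M s ℓ r) ψ 0 ≤
              channelEnergy (linePotential M s ℓ r) xc (ρ - h) ψ atTop) :
    ∀ M : ℝ, 0 < M → ∀ ρ : ℝ, 0 < ρ → ∃ h : ℝ, 0 ≤ h ∧ ∃ c : ℝ, 0 < c ∧ ∀ (r : ℝ → ℝ) (xc : ℝ),
      IsTortoiseRadius M r xc → ∀ (s ℓ : ℕ), s ≤ 2 → s ≤ ℓ → ∀ ψ : ℝ → ℝ → ℝ,
        IsRWSolution M s ℓ r ψ → (∀ t x, ψ (-t) x = σ * ψ t x) →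
        CauchyDataSupportedOn ψ {x : ℝ | ρ < |x - xc|} →
          ENNReal.ofReal c * totalEnergy (linePotential M s ℓ r) ψ 0 ≤
            channelEnergy (linePotential M s ℓ r) xc (ρ - h) ψ atTop := by
  intro M hM ρ hρ
  obtain ⟨h, hh, c, hc, H'⟩ := H M hM ρ hρ
  refine ⟨h, hh, c, hc, ?_⟩
  intro r xc hr s ℓ hs hsℓ ψ hψ hpar hsupp
  by_cases hE : totalEnergy (linePotential M s ℓ r) ψ 0 = ⊤
  · obtain ⟨h1, -⟩ :=
      WindowedShellChannels.Negative.channelEnergy_eq_top_of_totalEnergy_eq_top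
        (RW.differentiable_linePotential hr s ℓ) (fun x => (RW.linePotential_pos hr hsℓ x).le)
        hψ xc (ρ - h) hE
    rw [h1]
    exact le_top
  · exact H' r xc hr s ℓ hs hsℓ ψ hψ hpar hsupp hE



namespace Recentre

variable {V : ℝ → ℝ} {ψ : ℝ → ℝ → ℝ}

/-- Spatial translates `ψ(·, · + c)` of a global `C²` solution for the potential `V` are global
`C²` solutions for the translated potential `V(· + c)`. -/
theorem isSolution_xshift (hψ : IsSolution V ψ) (c : ℝ) :
    IsSolution (fun y => V (y + c)) (fun t y => ψ t (y + c)) := by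
  refine ⟨hψ.1.comp (contDiff_fst.prodMk (contDiff_snd.add contDiff_const)), fun z => ?_⟩
  have h := hψ.2 (z.1, z.2 + c)
  have h1 : iteratedDeriv 2 (fun y => ψ z.1 (y + c)) z.2 = iteratedDeriv 2 (ψ z.1) (z.2 + c) := by
    rw [iteratedDeriv_comp_add_const 2 (ψ z.1) c]
  unfold IsSolutionAt at h ⊢
  simp only at h ⊢
  rw [h1]
  exact h

/-- The energy density of the spatial translate is the translated energy density. -/
theorem energyDensity_xshift (V : ℝ → ℝ) (ψ : ℝ → ℝ → ℝ) (c t y : ℝ) :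
    energyDensity (fun y => V (y + c)) (fun t y => ψ t (y + c)) t y
      = energyDensity V ψ t (y + c) := by
  unfold energyDensity
  rw [deriv_comp_add_const (ψ t) c y]

/-- The total energy is invariant under spatial translation. -/
theorem totalEnergy_xshift (V : ℝ → ℝ) (ψ : ℝ → ℝ → ℝ) (c t : ℝ) :
    totalEnergy (fun y => V (y + c)) (fun t y => ψ t (y + c)) t = totalEnergy V ψ t := by
  unfold totalEnergy
  simp only [energyDensity_xshift]
  exact (measurePreserving_add_right volume c).lintegral_comp_emb (measurableEmbedding_addRight c)
    (fun x => ENNReal.ofReal (energyDensity V ψ t x))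

/-- Exterior energies of the spatial translate about `xc` are the exterior energies of `ψ` about
the translated centre `xc + c`. -/
theorem exteriorEnergy_xshift (V : ℝ → ℝ) (ψ : ℝ → ℝ → ℝ) (c xc a t : ℝ) :
    exteriorEnergy (fun y => V (y + c)) xc a (fun t y => ψ t (y + c)) t
      = exteriorEnergy V (xc + c) a ψ t := by
  unfold exteriorEnergy
  simp only [energyDensity_xshift]
  have hset : {y : ℝ | a + |t| < |y - xc|}
      = (fun y : ℝ => y + c) ⁻¹' {x : ℝ | a + |t| < |x - (xc + c)|} := by
    ext y
    simp only [mem_setOf_eq, mem_preimage]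
    rw [show y + c - (xc + c) = y - xc by ring]
  rw [hset]
  exact (measurePreserving_add_right volume c).setLIntegral_comp_preimage_emb
    (measurableEmbedding_addRight c) (fun x => ENNReal.ofReal (energyDensity V ψ t x))
    {x : ℝ | a + |t| < |x - (xc + c)|}

/-- Channel energies of the spatial translate about `xc` are the channel energies of `ψ` about
the translated centre `xc + c`. -/
theorem channelEnergy_xshift (V : ℝ → ℝ) (ψ : ℝ → ℝ → ℝ) (c xc a : ℝ)
    (l : Filter ℝ) :
    channelEnergy (fun y => V (y + c)) xc a (fun t y => ψ t (y + c)) l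
      = channelEnergy V (xc + c) a ψ l := by
  unfold channelEnergy
  congr 1
  funext t
  exact exteriorEnergy_xshift V ψ c xc a t

/-- Cauchy data supported off the shell `{|x − xc| ≤ ρ}` translate to Cauchy data supported off
`{|y| ≤ ρ}`. -/
theorem supported_xshift {ρ xc : ℝ}
    (hsupp : CauchyDataSupportedOn ψ {x : ℝ | ρ < |x - xc|}) :
    CauchyDataSupportedOn (fun t y => ψ t (y + xc)) {y : ℝ | ρ < |y|} := by
  intro y hy
  have hx : y + xc ∉ {x : ℝ | ρ < |x - xc|} := by simpa using hy
  exact hsupp (y + xc) hx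

/-- Recentring the radius function: a tortoise radius function with the photon sphere at `xc` is
the translate of the explicit one centred at `0`, `tortoiseRadius hM 0 y = r (y + xc)`. -/
theorem tortoiseRadius_zero_eq {M : ℝ} {r : ℝ → ℝ} {xc : ℝ} (hr : IsTortoiseRadius M r xc)
    (hM : 0 < M) : tortoiseRadius hM 0 = fun y => r (y + xc) := by
  have h1 := hr.comp_sub_add 0
  simp only [sub_zero] at h1
  exact (isTortoiseRadius_tortoiseRadius hM 0).unique h1

/-- Hence the line potential along `tortoiseRadius hM 0` is the spatial translate of the line
potential along `r`. -/
theorem linePotential_tortoiseRadius_zero_eq {M : ℝ} {r : ℝ → ℝ} {xc : ℝ}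
    (hr : IsTortoiseRadius M r xc) (hM : 0 < M) (s ℓ : ℕ) :
    linePotential M s ℓ (tortoiseRadius hM 0) = fun y => linePotential M s ℓ r (y + xc) := by
  funext y
  simp only [linePotential_apply, tortoiseRadius_zero_eq hr hM]

end Recentre

/-- REDUCTION (recentring): a tortoise radius function with photon sphere at `xc` is `tortoiseRadius hM 0 (· − xc)`
(`IsTortoiseRadius.eq_tortoiseRadius`, `comp_sub_add`, `unique`); `ψ₀(t, y) := ψ(t, y + xc)` is a solution along
`tortoiseRadius hM 0` with the same parity, data supported off `{|y| ≤ ρ}`, the same energies (translation invariance of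
Lebesgue measure) and `exteriorEnergy … 0 a ψ₀ t = exteriorEnergy … xc a ψ t`. -/
theorem landed_recentre (σ : ℝ)
    (H : ∀ (M : ℝ) (hM : 0 < M), ∀ ρ : ℝ, 0 < ρ → ∃ h : ℝ, 0 ≤ h ∧ ∃ c : ℝ, 0 < c ∧
        ∀ (s ℓ : ℕ), s ≤ 2 → s ≤ ℓ → ∀ ψ : ℝ → ℝ → ℝ,
          IsRWSolution M s ℓ (tortoiseRadius hM 0) ψ → (∀ t x, ψ (-t) x = σ * ψ t x) →
          CauchyDataSupportedOn ψ {x : ℝ | ρ < |x|} →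
          totalEnergy (linePotential M s ℓ (tortoiseRadius hM 0)) ψ 0 ≠ ⊤ →
            ENNReal.ofReal c * totalEnergy (linePotential M s ℓ (tortoiseRadius hM 0)) ψ 0 ≤
              channelEnergy (linePotential M s ℓ (tortoiseRadius hM 0)) 0 (ρ - h) ψ atTop) :
    ∀ M : ℝ, 0 < M → ∀ ρ : ℝ, 0 < ρ → ∃ h : ℝ, 0 ≤ h ∧ ∃ c : ℝ, 0 < c ∧ ∀ (r : ℝ → ℝ) (xc : ℝ),
      IsTortoiseRadius M r xc → ∀ (s ℓ : ℕ), s ≤ 2 → s ≤ ℓ → ∀ ψ : ℝ → ℝ → ℝ,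
        IsRWSolution M s ℓ r ψ → (∀ t x, ψ (-t) x = σ * ψ t x) →
        CauchyDataSupportedOn ψ {x : ℝ | ρ < |x - xc|} →
        totalEnergy (linePotential M s ℓ r) ψ 0 ≠ ⊤ →
          ENNReal.ofReal c * totalEnergy (linePotential M s ℓ r) ψ 0 ≤
            channelEnergy (linePotential M s ℓ r) xc (ρ - h) ψ atTop := by
  intro M hM ρ hρ
  obtain ⟨h, hh, c, hc, H'⟩ := H M hM ρ hρ
  refine ⟨h, hh, c, hc, fun r xc hr s ℓ hs hsℓ ψ hψ hpar hsupp hE => ?_⟩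
  have hV := Recentre.linePotential_tortoiseRadius_zero_eq hr hM s ℓ
  have hsol : IsRWSolution M s ℓ (tortoiseRadius hM 0) (fun t y => ψ t (y + xc)) := by
    show IsSolution (linePotential M s ℓ (tortoiseRadius hM 0)) (fun t y => ψ t (y + xc))
    rw [hV]
    exact Recentre.isSolution_xshift hψ xc
  have hpar' : ∀ t y, (fun t y => ψ t (y + xc)) (-t) y = σ * (fun t y => ψ t (y + xc)) t y :=
    fun t y => hpar t (y + xc)
  have hE' : totalEnergy (linePotential M s ℓ (tortoiseRadius hM 0))
      (fun t y => ψ t (y + xc)) 0 ≠ ⊤ := by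
    rw [hV, Recentre.totalEnergy_xshift]
    exact hE
  have K :=
    H' s ℓ hs hsℓ (fun t y => ψ t (y + xc)) hsol hpar' (Recentre.supported_xshift hsupp) hE'
  rw [hV, Recentre.totalEnergy_xshift, Recentre.channelEnergy_xshift, zero_add] at K
  exact K


/-! ## Skeleton v3 proper (identical to work/WindowedShellChannels.lean) -/

/-! ## The three open stubs -/

/-- STUB (M — pure 1-D wave energetics).  **Completion duality for two finite-energy solutions** of
`ψ_tt − ψ_xx + Vψ = 0`, `V ≥ 0` differentiable: if the energy pairing of `a` and `j` at `t = 0` equals `E(j)`,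
`E(a) ≤ A·E(j)`, and `a` loses at most `θ²E(j)` behind the (possibly lagged, `b < 0`) forward cone `{b + |t| < |x|}`,
then `j` radiates at least `((1 − θ)²/A)·E(j)` ahead of the same cone.  Proof: polarisation of the exterior /
interior energies (positive quadratic forms), Cauchy–Schwarz, conservation of the pairing
(`RW.totalEnergy_eq_totalEnergy` on `a ± j`), limits `t → +∞` (`Parity.tendsto_exteriorEnergy_atTop`). -/
theorem stub_duality :
    ∀ (V : ℝ → ℝ), Differentiable ℝ V → (∀ x, 0 ≤ V x) →
    ∀ (a j : ℝ → ℝ → ℝ), IsSolution V a → IsSolution V j →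
    totalEnergy V a 0 ≠ ⊤ → totalEnergy V j 0 ≠ ⊤ →
    ∀ (A θ b : ℝ), 0 < A → 0 ≤ θ → θ < 1 →
    (∫ x, (deriv (fun τ => a τ x) 0 * deriv (fun τ => j τ x) 0 + deriv (a 0) x * deriv (j 0) x
        + V x * (a 0 x * j 0 x))) = (totalEnergy V j 0).toReal →
    totalEnergy V a 0 ≤ ENNReal.ofReal A * totalEnergy V j 0 →
    totalEnergy V a 0 ≤ channelEnergy V 0 b a atTop + ENNReal.ofReal (θ ^ 2) * totalEnergy V j 0 →
    ENNReal.ofReal ((1 - θ) ^ 2 / A) * totalEnergy V j 0 ≤ channelEnergy V 0 b j atTop := by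
  sorry

/-- STUB (the analytic core, even parity).  **Outward-partner escape for standing starts**, unit mass, centred
tortoise line, uniformly in `s ≤ 2`, `ℓ ≥ s`: for every shell half-width `ρ > 0` there are a lag `h ≥ 0`, a bound
`A > 0` and a defect `θ < 1` such that every finite-energy time-EVEN Regge–Wheeler solution `ψ` (data `(ψ₀, 0)`)
with Cauchy data vanishing on `{|x| ≤ ρ}` admits a finite-energy partner solution `φ` with energy pairing
`⟨φ, ψ⟩_E(0) = E(ψ)` (e.g. `φ(0,·) = ψ₀`), `E(φ) ≤ A·E(ψ)`, losing at most `θ²·E(ψ)` behind the lagged forward cone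
`{ρ − h + |t| < |x|}`.  Canonical partner: the OUTWARD completion `(ψ₀, −sign(x)·ψ₀′)` (`A = 2`), whose
bicharacteristics all recede from the photon sphere; θ is then its late-radiation fraction (reflection off the
potential's slopes + the sub-barrier straddling of the cone), to be bounded uniformly in `ℓ`. -/
theorem stub_escapeEven :
    ∀ ρ : ℝ, 0 < ρ → ∃ h : ℝ, 0 ≤ h ∧ ∃ A : ℝ, 0 < A ∧ ∃ θ : ℝ, 0 ≤ θ ∧ θ < 1 ∧
      ∀ (s ℓ : ℕ), s ≤ 2 → s ≤ ℓ → ∀ ψ : ℝ → ℝ → ℝ,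
        IsRWSolution 1 s ℓ (tortoiseRadius one_pos 0) ψ → (∀ t x, ψ (-t) x = ψ t x) →
        CauchyDataSupportedOn ψ {x : ℝ | ρ < |x|} →
        totalEnergy (linePotential 1 s ℓ (tortoiseRadius one_pos 0)) ψ 0 ≠ ⊤ →
        ∃ φ : ℝ → ℝ → ℝ, IsRWSolution 1 s ℓ (tortoiseRadius one_pos 0) φ ∧
          totalEnergy (linePotential 1 s ℓ (tortoiseRadius one_pos 0)) φ 0 ≠ ⊤ ∧
          (∫ x, (deriv (fun τ => φ τ x) 0 * deriv (fun τ => ψ τ x) 0 + deriv (φ 0) x * deriv (ψ 0) x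
              + linePotential 1 s ℓ (tortoiseRadius one_pos 0) x * (φ 0 x * ψ 0 x)))
            = (totalEnergy (linePotential 1 s ℓ (tortoiseRadius one_pos 0)) ψ 0).toReal ∧
          totalEnergy (linePotential 1 s ℓ (tortoiseRadius one_pos 0)) φ 0 ≤
            ENNReal.ofReal A * totalEnergy (linePotential 1 s ℓ (tortoiseRadius one_pos 0)) ψ 0 ∧
          totalEnergy (linePotential 1 s ℓ (tortoiseRadius one_pos 0)) φ 0 ≤
            channelEnergy (linePotential 1 s ℓ (tortoiseRadius one_pos 0)) 0 (ρ - h) φ atTop +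
              ENNReal.ofReal (θ ^ 2) * totalEnergy (linePotential 1 s ℓ (tortoiseRadius one_pos 0)) ψ 0 := by
  sorry

/-- STUB (the analytic core, odd parity).  **Outward-partner escape for pure kicks** (data `(0, g)`), same shape as
`stub_escapeEven` with time-ODD `ψ`.  The pairing condition is automatic for any partner with `φ_t(0,·) = g`
(`⟨φ, ψ⟩_E(0) = ∫ g² = E(ψ)`), so the content is: SOME position profile `φ₀` (with `E(φ₀, g) ≤ A ∫ g²`) makes
`(φ₀, g)` radiate promptly all but `θ² ∫ g²`; canonical choice: the outward primitive of the mollified-away high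
part of `g` (mollifier scale `≍ 1/ℓ`, which keeps `∫ Vφ₀² ≲ ∫ g²` uniformly in `ℓ` and `φ₀` supported off the
half-shell). -/
theorem stub_escapeOdd :
    ∀ ρ : ℝ, 0 < ρ → ∃ h : ℝ, 0 ≤ h ∧ ∃ A : ℝ, 0 < A ∧ ∃ θ : ℝ, 0 ≤ θ ∧ θ < 1 ∧
      ∀ (s ℓ : ℕ), s ≤ 2 → s ≤ ℓ → ∀ ψ : ℝ → ℝ → ℝ,
        IsRWSolution 1 s ℓ (tortoiseRadius one_pos 0) ψ → (∀ t x, ψ (-t) x = -ψ t x) →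
        CauchyDataSupportedOn ψ {x : ℝ | ρ < |x|} →
        totalEnergy (linePotential 1 s ℓ (tortoiseRadius one_pos 0)) ψ 0 ≠ ⊤ →
        ∃ φ : ℝ → ℝ → ℝ, IsRWSolution 1 s ℓ (tortoiseRadius one_pos 0) φ ∧
          totalEnergy (linePotential 1 s ℓ (tortoiseRadius one_pos 0)) φ 0 ≠ ⊤ ∧
          (∫ x, (deriv (fun τ => φ τ x) 0 * deriv (fun τ => ψ τ x) 0 + deriv (φ 0) x * deriv (ψ 0) x
              + linePotential 1 s ℓ (tortoiseRadius one_pos 0) x * (φ 0 x * ψ 0 x)))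
            = (totalEnergy (linePotential 1 s ℓ (tortoiseRadius one_pos 0)) ψ 0).toReal ∧
          totalEnergy (linePotential 1 s ℓ (tortoiseRadius one_pos 0)) φ 0 ≤
            ENNReal.ofReal A * totalEnergy (linePotential 1 s ℓ (tortoiseRadius one_pos 0)) ψ 0 ∧
          totalEnergy (linePotential 1 s ℓ (tortoiseRadius one_pos 0)) φ 0 ≤
            channelEnergy (linePotential 1 s ℓ (tortoiseRadius one_pos 0)) 0 (ρ - h) φ atTop +
              ENNReal.ofReal (θ ^ 2) * totalEnergy (linePotential 1 s ℓ (tortoiseRadius one_pos 0)) ψ 0 := by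
  sorry

/-! ## Proved glue -/

/-- GLUE: duality + σ-escape ⇒ the σ-core (the hypothesis `H` of the landed `stub_unitMass σ`), with the same lag and
`c = (1 − θ)²/A`. -/
theorem core_of_duality_escape {σ : ℝ}
    (hdual : ∀ (V : ℝ → ℝ), Differentiable ℝ V → (∀ x, 0 ≤ V x) →
      ∀ (a j : ℝ → ℝ → ℝ), IsSolution V a → IsSolution V j →
      totalEnergy V a 0 ≠ ⊤ → totalEnergy V j 0 ≠ ⊤ →
      ∀ (A θ b : ℝ), 0 < A → 0 ≤ θ → θ < 1 →
      (∫ x, (deriv (fun τ => a τ x) 0 * deriv (fun τ => j τ x) 0 + deriv (a 0) x * deriv (j 0) x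
          + V x * (a 0 x * j 0 x))) = (totalEnergy V j 0).toReal →
      totalEnergy V a 0 ≤ ENNReal.ofReal A * totalEnergy V j 0 →
      totalEnergy V a 0 ≤ channelEnergy V 0 b a atTop + ENNReal.ofReal (θ ^ 2) * totalEnergy V j 0 →
      ENNReal.ofReal ((1 - θ) ^ 2 / A) * totalEnergy V j 0 ≤ channelEnergy V 0 b j atTop)
    (hesc : ∀ ρ : ℝ, 0 < ρ → ∃ h : ℝ, 0 ≤ h ∧ ∃ A : ℝ, 0 < A ∧ ∃ θ : ℝ, 0 ≤ θ ∧ θ < 1 ∧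
      ∀ (s ℓ : ℕ), s ≤ 2 → s ≤ ℓ → ∀ ψ : ℝ → ℝ → ℝ,
        IsRWSolution 1 s ℓ (tortoiseRadius one_pos 0) ψ → (∀ t x, ψ (-t) x = σ * ψ t x) →
        CauchyDataSupportedOn ψ {x : ℝ | ρ < |x|} →
        totalEnergy (linePotential 1 s ℓ (tortoiseRadius one_pos 0)) ψ 0 ≠ ⊤ →
        ∃ φ : ℝ → ℝ → ℝ, IsRWSolution 1 s ℓ (tortoiseRadius one_pos 0) φ ∧
          totalEnergy (linePotential 1 s ℓ (tortoiseRadius one_pos 0)) φ 0 ≠ ⊤ ∧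
          (∫ x, (deriv (fun τ => φ τ x) 0 * deriv (fun τ => ψ τ x) 0 + deriv (φ 0) x * deriv (ψ 0) x
              + linePotential 1 s ℓ (tortoiseRadius one_pos 0) x * (φ 0 x * ψ 0 x)))
            = (totalEnergy (linePotential 1 s ℓ (tortoiseRadius one_pos 0)) ψ 0).toReal ∧
          totalEnergy (linePotential 1 s ℓ (tortoiseRadius one_pos 0)) φ 0 ≤
            ENNReal.ofReal A * totalEnergy (linePotential 1 s ℓ (tortoiseRadius one_pos 0)) ψ 0 ∧
          totalEnergy (linePotential 1 s ℓ (tortoiseRadius one_pos 0)) φ 0 ≤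
            channelEnergy (linePotential 1 s ℓ (tortoiseRadius one_pos 0)) 0 (ρ - h) φ atTop +
              ENNReal.ofReal (θ ^ 2) * totalEnergy (linePotential 1 s ℓ (tortoiseRadius one_pos 0)) ψ 0) :
    ∀ ρ : ℝ, 0 < ρ → ∃ h : ℝ, 0 ≤ h ∧ ∃ c : ℝ, 0 < c ∧
      ∀ (s ℓ : ℕ), s ≤ 2 → s ≤ ℓ → ∀ ψ : ℝ → ℝ → ℝ,
        IsRWSolution 1 s ℓ (tortoiseRadius one_pos 0) ψ → (∀ t x, ψ (-t) x = σ * ψ t x) →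
        CauchyDataSupportedOn ψ {x : ℝ | ρ < |x|} →
        totalEnergy (linePotential 1 s ℓ (tortoiseRadius one_pos 0)) ψ 0 ≠ ⊤ →
          ENNReal.ofReal c * totalEnergy (linePotential 1 s ℓ (tortoiseRadius one_pos 0)) ψ 0 ≤
            channelEnergy (linePotential 1 s ℓ (tortoiseRadius one_pos 0)) 0 (ρ - h) ψ atTop := by
  intro ρ hρ
  obtain ⟨h, hh, A, hA, θ, hθ0, hθ1, H⟩ := hesc ρ hρ
  have hθ' : 0 < 1 - θ := by linarith
  refine ⟨h, hh, (1 - θ) ^ 2 / A, by positivity, ?_⟩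
  intro s ℓ hs hsℓ ψ hψ hpar hsupp hE
  obtain ⟨φ, hφ, hEφ, hpair, hAφ, hlost⟩ := H s ℓ hs hsℓ ψ hψ hpar hsupp hE
  have hr := isTortoiseRadius_tortoiseRadius one_pos (0 : ℝ)
  exact hdual _ (RW.differentiable_linePotential hr s ℓ) (fun x => (RW.linePotential_pos hr hsℓ x).le)
    φ ψ hφ hψ hEφ hE A θ (ρ - h) hA hθ0 hθ1 hpair hAφ hlost

/-- Parity bookkeeping: `ψ(−t) = ψ(t)` iff `ψ(−t) = 1·ψ(t)`. -/
theorem even_iff_one_mul (ψ : ℝ → ℝ → ℝ) :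
    (∀ t x, ψ (-t) x = ψ t x) ↔ ∀ t x, ψ (-t) x = 1 * ψ t x := by
  simp only [one_mul]

/-- Parity bookkeeping: `ψ(−t) = −ψ(t)` iff `ψ(−t) = (−1)·ψ(t)`. -/
theorem odd_iff_neg_one_mul (ψ : ℝ → ℝ → ℝ) :
    (∀ t x, ψ (-t) x = -ψ t x) ↔ ∀ t x, ψ (-t) x = -1 * ψ t x := by
  simp only [neg_mul, one_mul]

/-- The even core (centred, unit mass, finite energy), from duality + even escape. -/
theorem coreEven_of :
    ∀ ρ : ℝ, 0 < ρ → ∃ h : ℝ, 0 ≤ h ∧ ∃ c : ℝ, 0 < c ∧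
      ∀ (s ℓ : ℕ), s ≤ 2 → s ≤ ℓ → ∀ ψ : ℝ → ℝ → ℝ,
        IsRWSolution 1 s ℓ (tortoiseRadius one_pos 0) ψ → (∀ t x, ψ (-t) x = 1 * ψ t x) →
        CauchyDataSupportedOn ψ {x : ℝ | ρ < |x|} →
        totalEnergy (linePotential 1 s ℓ (tortoiseRadius one_pos 0)) ψ 0 ≠ ⊤ →
          ENNReal.ofReal c * totalEnergy (linePotential 1 s ℓ (tortoiseRadius one_pos 0)) ψ 0 ≤
            channelEnergy (linePotential 1 s ℓ (tortoiseRadius one_pos 0)) 0 (ρ - h) ψ atTop := by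
  refine core_of_duality_escape stub_duality fun ρ hρ => ?_
  obtain ⟨h, hh, A, hA, θ, hθ0, hθ1, H⟩ := stub_escapeEven ρ hρ
  exact ⟨h, hh, A, hA, θ, hθ0, hθ1, fun s ℓ hs hsℓ ψ hψ hpar =>
    H s ℓ hs hsℓ ψ hψ ((even_iff_one_mul ψ).2 hpar)⟩

/-- The odd core (centred, unit mass, finite energy), from duality + odd escape. -/
theorem coreOdd_of :
    ∀ ρ : ℝ, 0 < ρ → ∃ h : ℝ, 0 ≤ h ∧ ∃ c : ℝ, 0 < c ∧
      ∀ (s ℓ : ℕ), s ≤ 2 → s ≤ ℓ → ∀ ψ : ℝ → ℝ → ℝ,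
        IsRWSolution 1 s ℓ (tortoiseRadius one_pos 0) ψ → (∀ t x, ψ (-t) x = -1 * ψ t x) →
        CauchyDataSupportedOn ψ {x : ℝ | ρ < |x|} →
        totalEnergy (linePotential 1 s ℓ (tortoiseRadius one_pos 0)) ψ 0 ≠ ⊤ →
          ENNReal.ofReal c * totalEnergy (linePotential 1 s ℓ (tortoiseRadius one_pos 0)) ψ 0 ≤
            channelEnergy (linePotential 1 s ℓ (tortoiseRadius one_pos 0)) 0 (ρ - h) ψ atTop := by
  refine core_of_duality_escape stub_duality fun ρ hρ => ?_
  obtain ⟨h, hh, A, hA, θ, hθ0, hθ1, H⟩ := stub_escapeOdd ρ hρ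
  exact ⟨h, hh, A, hA, θ, hθ0, hθ1, fun s ℓ hs hsℓ ψ hψ hpar =>
    H s ℓ hs hsℓ ψ hψ ((odd_iff_neg_one_mul ψ).2 hpar)⟩

/-! ## The composition -/

/-- **The crux from the stubs.**  `stub_parity ∘ stub_finiteEnergy ∘ stub_recentre ∘ stub_unitMass` (all landed)
applied to the two cores `coreEven_of`, `coreOdd_of` (duality + escape). -/
theorem WindowedShellChannels_of : WindowedShellChannels := by
  unfold WindowedShellChannels
  refine landed_parity ?_ ?_
  · intro M hM ρ hρ
    obtain ⟨h, hh, c, hc, H⟩ :=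
      landed_finiteEnergy 1 (landed_recentre 1 (WindowedShellChannelsStubs.stub_unitMass 1 coreEven_of)) M hM ρ hρ
    exact ⟨h, hh, c, hc, fun r xc hr s ℓ hs hsℓ ψ hψ hpar =>
      H r xc hr s ℓ hs hsℓ ψ hψ ((even_iff_one_mul ψ).1 hpar)⟩
  · intro M hM ρ hρ
    obtain ⟨h, hh, c, hc, H⟩ :=
      landed_finiteEnergy (-1) (landed_recentre (-1) (WindowedShellChannelsStubs.stub_unitMass (-1) coreOdd_of)) M hM ρ hρ
    exact ⟨h, hh, c, hc, fun r xc hr s ℓ hs hsℓ ψ hψ hpar =>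
      H r xc hr s ℓ hs hsℓ ψ hψ ((odd_iff_neg_one_mul ψ).1 hpar)⟩

end Summit.FinalStateConjecture.FinalStateConjecture.Theorems.WindowedShellChannelsLine

end
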